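import Summits.ABC.StewartYu.SatBoxCount
import HarnessLib

/-!
# A FLOOR-FREE count of lattice points: some TRANSLATE of a thin box carries its share of `𝔑`-points
# (the discrete coset average over `(1/N)ℤⁿ ⊇ 𝔑 ⊇ ℤⁿ`; plan RULING R32 (a), START deliverable of the r2 line)

`Summits/ABC/StewartYu/SatBoxTranslate.lean` — cell `abc-stewartyu` (HOME `run/shared/lean/pub/abc-stewartyu/`), route
`YuMatveevShapeRat` (rung A1.L, crux r2 `ArchCoreRat`, stmt-ABC-20502), seat p4 (g9; geometry-of-numbers lane), for the START of
the 𝔑-threaded archimedean frame (owner p1).  Theorems only.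

The tree's count N1 (`Dioph.exists_finset_lattice_box`, and p1's θ-coordinate transport `SatBox.card_satBox_ge`) fills the box
`|xⱼ| ≤ sⱼ` with INTEGER sides `sⱼ ≥ 1`, which forces the scale floor `L ≥ 2Amax` on the record (sides `σⱼ = L/(2Aⱼ)`); with
`N = [𝔑 : ℤⁿ]` threaded that floor re-creates an `Amax·log N` term next to `log(eB)` (lit 17:06:59Z, R32 (b) FLOORS).  Print
counts `𝔑 ∩ (v + box)` for a suitable translate `v` by Blichfeldt (Nesterenko 2003, Prop. 3.4 (2), p. 102–104: «fix `v`,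
`l − v ∈ 𝔑`»).  The discrete substitute proved here: if `ℤⁿ ≤ 𝔑 ≤ (1/N)ℤⁿ` (`N·𝔑 ⊆ ℤⁿ`, as for the saturation lattice
`𝔑 = {λ : α^λ ∈ ℚ}` with `N = [𝔑 : ℤⁿ]`), then for all `mⱼ ∈ ℕ` some translate `t + ∏ⱼ[−mⱼ/N, mⱼ/N]` of the box with
sides `mⱼ/N` contains at least `[𝔑 : ℤⁿ]·∏ⱼ(2mⱼ+1)/Nⁿ` points of `𝔑` — the `∏(2mⱼ+1)` points of the grid `(1/N)ℤⁿ` in the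
box fall into the `Nⁿ/[𝔑 : ℤⁿ]` cosets of `𝔑`, and the fullest coset, translated back, is the set.  With `mⱼ := ⌊Nσⱼ⌋` the
only floor is `σⱼ ≥ 1/N` (`2mⱼ + 1 ≥ 2Nσⱼ − 1`): `exists_translate_finset_lattice_box` (sides `mⱼ/N`),
`exists_translate_finset_lattice_box_real` (real sides `σⱼ`), `two_mul_floor_add_one_ge`.

WHAT THIS IS NOT: not Blichfeldt's theorem; not a statement about any frame; no crux moves.

References: Yu. V. Nesterenko, *Linear forms in logarithms of rational numbers*, LNM 1819 (2003), §3.3 Prop. 3.4 (2) and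
its use in §3.5 («fix `v ∈ 𝔚₀`», pp. 102–106); J. W. S. Cassels, *An Introduction to the Geometry of Numbers*, III §2
(Blichfeldt) — replaced here by a finite coset average [folklore].
-/

noncomputable section

open Finset Matrix

namespace Summit.ABC.StewartYu

namespace SatBox

variable {n : ℕ}

/-- The grid lattice `(1/N)ℤⁿ = {x : N•x ∈ ℤⁿ}` is `latN (N•1)`. [folklore] -/
theorem mem_latN_smul_one {N : ℕ} {x : Fin n → ℚ} :
    x ∈ latN ((N : ℤ) • (1 : Matrix (Fin n) (Fin n) ℤ)) ↔ ∃ z : Fin n → ℤ, (N : ℚ) • x = ιZQ n z := by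
  rw [mem_latN]
  have h : x ᵥ* ((N : ℤ) • (1 : Matrix (Fin n) (Fin n) ℤ)).map (Int.cast : ℤ → ℚ) = (N : ℚ) • x := by
    have hmap : ((N : ℤ) • (1 : Matrix (Fin n) (Fin n) ℤ)).map (Int.cast : ℤ → ℚ) =
        (N : ℚ) • (1 : Matrix (Fin n) (Fin n) ℚ) := by
      ext i j
      rw [Matrix.map_apply, Matrix.smul_apply, Matrix.smul_apply, smul_eq_mul, smul_eq_mul]
      by_cases hij : i = j
      · subst hij
        rw [Matrix.one_apply_eq, Matrix.one_apply_eq]; push_cast; ring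
      · rw [Matrix.one_apply_ne hij, Matrix.one_apply_ne hij]; push_cast; ring
    rw [hmap, Matrix.vecMul_smul, Matrix.vecMul_one]
  rw [h]

/-- `[(1/N)ℤⁿ : ℤⁿ] = Nⁿ`. [folklore] -/
theorem relIndex_closure_latN_smul_one {N : ℕ} (hN : 1 ≤ N) :
    (AddSubgroup.closure (Set.range ⇑(Pi.basisFun ℚ (Fin n)))).relIndex
      (latN ((N : ℤ) • (1 : Matrix (Fin n) (Fin n) ℤ))) = N ^ n := by
  have hdet : ((N : ℤ) • (1 : Matrix (Fin n) (Fin n) ℤ)).det = (N : ℤ) ^ n := by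
    rw [Matrix.det_smul, Matrix.det_one, mul_one, Fintype.card_fin]
  have hdet0 : ((N : ℤ) • (1 : Matrix (Fin n) (Fin n) ℤ)).det ≠ 0 := by
    rw [hdet]; exact pow_ne_zero _ (by exact_mod_cast (show N ≠ 0 by omega))
  rw [relIndex_closure_latN _ hdet0, hdet, Int.natAbs_pow, Int.natAbs_natCast]

/-- **FLOOR-FREE TRANSLATED BOX COUNT.**  Let `ℤⁿ ≤ 𝔑 ≤ ℚⁿ` with `N·𝔑 ⊆ ℤⁿ` (`N ≥ 1`).  For every `m : Fin n → ℕ` there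
are a translate `t` and a finite set `𝔏 ⊆ 𝔑` of points with `|xⱼ − tⱼ| ≤ mⱼ/N`, of cardinality
`#𝔏 ≥ [𝔑 : ℤⁿ]·∏ⱼ(2mⱼ+1)/Nⁿ` (stated as `[𝔑 : ℤⁿ]·∏(2mⱼ+1) ≤ Nⁿ·#𝔏`).
[cite: Nesterenko2003, §3.3 Prop 3.4 (2) (pp. 102–104), discrete coset-average form] -/
theorem exists_translate_finset_lattice_box (Λ : AddSubgroup (Fin n → ℚ))
    (hZ : AddSubgroup.closure (Set.range ⇑(Pi.basisFun ℚ (Fin n))) ≤ Λ) {N : ℕ} (hN : 1 ≤ N)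
    (hΛN : ∀ x ∈ Λ, ∃ z : Fin n → ℤ, (N : ℚ) • x = ιZQ n z) (m : Fin n → ℕ) :
    ∃ (t : Fin n → ℚ) (𝔏 : Finset (Fin n → ℚ)),
      (∀ x ∈ 𝔏, x ∈ Λ) ∧ (∀ x ∈ 𝔏, ∀ j, |x j - t j| ≤ (m j : ℚ) / N) ∧
      (AddSubgroup.closure (Set.range ⇑(Pi.basisFun ℚ (Fin n)))).relIndex Λ * ∏ j, (2 * m j + 1) ≤
        N ^ n * 𝔏.card := by
  classical
  set Zn := AddSubgroup.closure (Set.range ⇑(Pi.basisFun ℚ (Fin n))) with hZn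
  set M : AddSubgroup (Fin n → ℚ) := latN ((N : ℤ) • (1 : Matrix (Fin n) (Fin n) ℤ)) with hM
  have hNq : (N : ℚ) ≠ 0 := by exact_mod_cast (show N ≠ 0 by omega)
  -- `Λ ≤ M`
  have hΛM : Λ ≤ M := fun x hx => mem_latN_smul_one.mpr (hΛN x hx)
  -- indices: `[Λ : ℤⁿ]·[M : Λ] = [M : ℤⁿ] = Nⁿ`
  have hidx : Zn.relIndex Λ * Λ.relIndex M = N ^ n := by
    rw [AddSubgroup.relIndex_mul_relIndex Zn Λ M hZ hΛM, hM, relIndex_closure_latN_smul_one hN]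
  set K : AddSubgroup M := Λ.addSubgroupOf M with hK
  have hKidx : K.index = Λ.relIndex M := rfl
  have hKidx0 : K.index ≠ 0 := by
    intro h0
    have h := hidx
    rw [← hKidx, h0, mul_zero] at h
    exact pow_ne_zero n (show N ≠ 0 by omega) h.symm
  haveI : Fintype (M ⧸ K) := AddSubgroup.fintypeOfIndexNeZero hKidx0
  -- the grid `G = {k/N : |kⱼ| ≤ mⱼ}`
  set box : Finset (Fin n → ℤ) := Fintype.piFinset fun j => Finset.Icc (-(m j : ℤ)) (m j) with hbox
  set emb : (Fin n → ℤ) → (Fin n → ℚ) := fun k j => (k j : ℚ) / N with hemb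
  have hemb_inj : Function.Injective emb := by
    intro k k' h
    funext j
    have hj := congrFun h j
    simp only [hemb] at hj
    have := (div_left_inj' hNq).mp hj
    exact_mod_cast this
  set G : Finset (Fin n → ℚ) := box.image emb with hG
  have hGcard : G.card = ∏ j, (2 * m j + 1) := by
    rw [hG, Finset.card_image_of_injective _ hemb_inj, hbox, Fintype.card_piFinset]
    refine Finset.prod_congr rfl fun j _ => ?_
    rw [Int.card_Icc]
    omega
  have hGM : ∀ g ∈ G, g ∈ M := by
    intro g hg
    obtain ⟨k, -, rfl⟩ := Finset.mem_image.mp hg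
    refine mem_latN_smul_one.mpr ⟨k, ?_⟩
    funext j
    simp [hemb, mul_div_cancel₀ _ hNq]
  have hGbox : ∀ g ∈ G, ∀ j, |g j| ≤ (m j : ℚ) / N := by
    intro g hg j
    obtain ⟨k, hk, rfl⟩ := Finset.mem_image.mp hg
    have hkj : k j ∈ Finset.Icc (-(m j : ℤ)) (m j) := Fintype.mem_piFinset.mp hk j
    rw [Finset.mem_Icc] at hkj
    simp only [hemb, abs_div, Nat.abs_cast]
    refine div_le_div_of_nonneg_right ?_ (by positivity)
    have : |(k j : ℚ)| ≤ (m j : ℚ) := by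
      rw [abs_le]; constructor <;> exact_mod_cast (by omega)
    exact this
  have h0G : (0 : Fin n → ℚ) ∈ G := by
    refine Finset.mem_image.mpr ⟨0, ?_, ?_⟩
    · exact Fintype.mem_piFinset.mpr fun j => by simp
    · funext j; simp [hemb]
  -- the class map and the fullest class
  set cls : (Fin n → ℚ) → M ⧸ K := fun x => if hx : x ∈ M then QuotientAddGroup.mk ⟨x, hx⟩ else 0 with hcls
  set tset : Finset (M ⧸ K) := G.image cls with htset
  have htne : tset.Nonempty := ⟨cls 0, Finset.mem_image_of_mem _ h0G⟩
  obtain ⟨y₀, hy₀, hmax⟩ := Finset.exists_max_image tset (fun y => (G.filter fun g => cls g = y).card) htne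
  set F : Finset (Fin n → ℚ) := G.filter fun g => cls g = y₀ with hF
  have hsum : G.card = ∑ y ∈ tset, (G.filter fun g => cls g = y).card :=
    Finset.card_eq_sum_card_image cls G
  have hGle : G.card ≤ tset.card * F.card := by
    rw [hsum]
    have := Finset.sum_le_card_nsmul tset (fun y => (G.filter fun g => cls g = y).card) F.card
      (fun y hy => hmax y hy)
    simpa using this
  have htcard : tset.card ≤ K.index := by
    rw [AddSubgroup.index_eq_card, Nat.card_eq_fintype_card]
    exact Finset.card_le_univ _
  -- `F` is nonempty; pick `g₀`
  have hFne : F.Nonempty := by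
    rw [← Finset.card_pos]
    by_contra h0
    push Not at h0
    have hF0 : F.card = 0 := by omega
    have hG0 : G.card = 0 := by
      have h := hGle
      rw [hF0, mul_zero] at h
      omega
    rw [Finset.card_eq_zero] at hG0
    rw [hG0] at h0G
    simp at h0G
  obtain ⟨g₀, hg₀⟩ := hFne
  have hg₀G : g₀ ∈ G := (Finset.mem_filter.mp hg₀).1
  have hg₀cls : cls g₀ = y₀ := (Finset.mem_filter.mp hg₀).2
  -- the set: `F − g₀`
  refine ⟨-g₀, F.image (fun g => g - g₀), ?_, ?_, ?_⟩
  · -- membership in `Λ`: same class ⇒ difference in `Λ`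
    intro x hx
    obtain ⟨g, hg, rfl⟩ := Finset.mem_image.mp hx
    have hgG : g ∈ G := (Finset.mem_filter.mp hg).1
    have hgcls : cls g = y₀ := (Finset.mem_filter.mp hg).2
    have hgM : g ∈ M := hGM g hgG
    have hg₀M : g₀ ∈ M := hGM g₀ hg₀G
    have hq : (QuotientAddGroup.mk (⟨g₀, hg₀M⟩ : M) : M ⧸ K) = QuotientAddGroup.mk ⟨g, hgM⟩ := by
      have h1 : cls g₀ = QuotientAddGroup.mk ⟨g₀, hg₀M⟩ := by simp [hcls, hg₀M]
      have h2 : cls g = QuotientAddGroup.mk ⟨g, hgM⟩ := by simp [hcls, hgM]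
      rw [← h1, ← h2, hg₀cls, hgcls]
    have hmem := QuotientAddGroup.eq.mp hq
    rw [hK, AddSubgroup.mem_addSubgroupOf] at hmem
    have : ((-(⟨g₀, hg₀M⟩ : M) + ⟨g, hgM⟩ : M) : Fin n → ℚ) = g - g₀ := by
      push_cast; ring
    rw [this] at hmem
    exact hmem
  · -- the box around `t = −g₀`
    intro x hx j
    obtain ⟨g, hg, rfl⟩ := Finset.mem_image.mp hx
    have hgG : g ∈ G := (Finset.mem_filter.mp hg).1
    simp only [Pi.sub_apply, Pi.neg_apply, sub_neg_eq_add, sub_add_cancel]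
    exact hGbox g hgG j
  · -- the count
    have hinj : Set.InjOn (fun g => g - g₀) ↑F := fun a _ b _ h => sub_left_injective h
    rw [Finset.card_image_of_injOn hinj, ← hGcard]
    calc Zn.relIndex Λ * G.card ≤ Zn.relIndex Λ * (tset.card * F.card) := Nat.mul_le_mul_left _ hGle
      _ ≤ Zn.relIndex Λ * (K.index * F.card) :=
          Nat.mul_le_mul_left _ (Nat.mul_le_mul_right _ htcard)
      _ = (Zn.relIndex Λ * Λ.relIndex M) * F.card := by rw [hKidx]; ring
      _ = N ^ n * F.card := by rw [hidx]

/-- `2·⌊Nσ⌋₊ + 1 ≥ 2Nσ − 1` (the only loss of the floor-free count: a floor `σ ≥ 1/N` keeps it positive).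
[folklore] -/
theorem two_mul_floor_add_one_ge (N : ℕ) (σ : ℝ) :
    2 * (N : ℝ) * σ - 1 ≤ (2 * ⌊(N : ℝ) * σ⌋₊ + 1 : ℕ) := by
  have h := Nat.lt_floor_add_one ((N : ℝ) * σ)
  push_cast
  linarith

/-- **FLOOR-FREE TRANSLATED BOX COUNT, real sides.**  As `exists_translate_finset_lattice_box` with `mⱼ := ⌊Nσⱼ⌋` for
real sides `σⱼ ≥ 0`: a translate `t` and `𝔏 ⊆ 𝔑` in `t + ∏[−σⱼ, σⱼ]` with `[𝔑 : ℤⁿ]·∏(2⌊Nσⱼ⌋+1) ≤ Nⁿ·#𝔏` (and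
`2⌊Nσⱼ⌋ + 1 ≥ 2Nσⱼ − 1`, `two_mul_floor_add_one_ge`). [cite: Nesterenko2003, §3.3 Prop 3.4 (2) (pp. 102–104), discrete form] -/
theorem exists_translate_finset_lattice_box_real (Λ : AddSubgroup (Fin n → ℚ))
    (hZ : AddSubgroup.closure (Set.range ⇑(Pi.basisFun ℚ (Fin n))) ≤ Λ) {N : ℕ} (hN : 1 ≤ N)
    (hΛN : ∀ x ∈ Λ, ∃ z : Fin n → ℤ, (N : ℚ) • x = ιZQ n z) (σ : Fin n → ℝ) (hσ : ∀ j, 0 ≤ σ j) :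
    ∃ (t : Fin n → ℚ) (𝔏 : Finset (Fin n → ℚ)),
      (∀ x ∈ 𝔏, x ∈ Λ) ∧ (∀ x ∈ 𝔏, ∀ j, |((x j : ℚ) : ℝ) - ((t j : ℚ) : ℝ)| ≤ σ j) ∧
      (AddSubgroup.closure (Set.range ⇑(Pi.basisFun ℚ (Fin n)))).relIndex Λ *
          ∏ j, (2 * ⌊(N : ℝ) * σ j⌋₊ + 1) ≤ N ^ n * 𝔏.card := by
  obtain ⟨t, 𝔏, hΛ, hbox, hcard⟩ :=
    exists_translate_finset_lattice_box Λ hZ hN hΛN (fun j => ⌊(N : ℝ) * σ j⌋₊)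
  refine ⟨t, 𝔏, hΛ, fun x hx j => ?_, hcard⟩
  have h := hbox x hx j
  have hNpos : (0 : ℝ) < N := by exact_mod_cast (show 0 < N by omega)
  have h1 : |((x j : ℚ) : ℝ) - ((t j : ℚ) : ℝ)| ≤ (⌊(N : ℝ) * σ j⌋₊ : ℝ) / N := by
    have : (((x j - t j : ℚ)) : ℝ) = ((x j : ℚ) : ℝ) - ((t j : ℚ) : ℝ) := by push_cast; ring
    rw [← this, ← Rat.cast_abs]
    have h2 : ((|x j - t j| : ℚ) : ℝ) ≤ (((⌊(N : ℝ) * σ j⌋₊ : ℚ) / N : ℚ) : ℝ) := by exact_mod_cast h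
    simpa using h2
  have h3 : (⌊(N : ℝ) * σ j⌋₊ : ℝ) / N ≤ σ j := by
    rw [div_le_iff₀ hNpos]
    have := Nat.floor_le (mul_nonneg hNpos.le (hσ j))
    linarith
  exact h1.trans h3

/-! ### The count in θ-coordinates (plan RULING R37 (i)): the virtual coordinates of the family lie in `N·(t + box)` -/

/-- **FLOOR-FREE TRANSLATED COUNT OF THE SATURATED FAMILY, θ-coordinates.**  For integer matrices `U, C` with `C·U = N·1`
(`N ≥ 1`; the saturation lattice is `𝔑 = 𝔑_C = {λ : λ ᵥ* C ∈ ℤⁿ}`, `[𝔑 : ℤⁿ] = |det C|`) and real sides `σⱼ ≥ 0`: a translate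
`t ∈ ℚⁿ` and a finite set `𝔅 ⊆ ℤⁿ` of exponent vectors `μ = λ ᵥ* C` (`λ ∈ 𝔑`) whose VIRTUAL coordinates `ν(μ) = μ ᵥ* U = N·λ` satisfy
`|ν(μ)ⱼ − N·tⱼ| ≤ N·σⱼ`, with `|det C|·∏ⱼ(2⌊Nσⱼ⌋+1) ≤ Nⁿ·#𝔅` (`2⌊Nσⱼ⌋+1 ≥ 2Nσⱼ − 1`: only floor `σⱼ ≥ 1/N`).  The θ-box of `𝔅`
is whatever `|Σⱼ (tⱼ ± σⱼ)·C j k|` gives; the frame's sizes are charged to `ν`. [cite: Nesterenko2003, §3.3 Prop 3.4 (2), §3.5 (the set 𝔏 at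
`v + box`), pp. 102–106; discrete form] -/
theorem exists_translate_satBox (N : ℕ) (hN : 1 ≤ N) (U C : Matrix (Fin n) (Fin n) ℤ)
    (hCU : C * U = (N : ℤ) • (1 : Matrix (Fin n) (Fin n) ℤ)) (σ : Fin n → ℝ) (hσ : ∀ j, 0 ≤ σ j) :
    ∃ (t : Fin n → ℚ) (𝔅 : Finset (Fin n → ℤ)),
      (∀ μ ∈ 𝔅, ∀ j, |(((μ ᵥ* U) j : ℤ) : ℝ) - (N : ℝ) * ((t j : ℚ) : ℝ)| ≤ (N : ℝ) * σ j) ∧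
      C.det.natAbs * ∏ j, (2 * ⌊(N : ℝ) * σ j⌋₊ + 1) ≤ N ^ n * 𝔅.card := by
  classical
  -- `det C ≠ 0`
  have hdet : C.det ≠ 0 := by
    intro h0
    have h := congrArg Matrix.det hCU
    rw [Matrix.det_mul, h0, zero_mul, Matrix.det_smul, Matrix.det_one, mul_one, Fintype.card_fin] at h
    exact pow_ne_zero _ (by exact_mod_cast (show N ≠ 0 by omega)) h.symm
  set Cq : Matrix (Fin n) (Fin n) ℚ := C.map (Int.cast : ℤ → ℚ) with hCq
  have hCUq : Cq * U.map (Int.cast : ℤ → ℚ) = (N : ℚ) • (1 : Matrix (Fin n) (Fin n) ℚ) := by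
    have hmap : (C * U).map (Int.cast : ℤ → ℚ) = Cq * U.map (Int.cast : ℤ → ℚ) := by
      rw [hCq]; ext i k; simp only [Matrix.map_apply, Matrix.mul_apply]; push_cast; rfl
    rw [← hmap, hCU]; ext i k
    simp only [Matrix.map_apply, Matrix.smul_apply, Matrix.one_apply, smul_eq_mul]
    split_ifs <;> simp
  -- `N·𝔑 ⊆ ℤⁿ`: `N·λ = (λ ᵥ* C) ᵥ* U`
  have hΛN : ∀ x ∈ latN C, ∃ z : Fin n → ℤ, (N : ℚ) • x = ιZQ n z := by
    intro x hx
    obtain ⟨z, hz⟩ := mem_latN.mp hx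
    refine ⟨z ᵥ* U, ?_⟩
    rw [← ιZQ_vecMul U z, ← hz, Matrix.vecMul_vecMul, ← hCq, hCUq, Matrix.vecMul_smul, Matrix.vecMul_one]
  obtain ⟨t, 𝔏, hmem, hbox, hcard⟩ :=
    exists_translate_finset_lattice_box_real (latN C) (closure_le_latN C) hN hΛN σ hσ
  rw [relIndex_closure_latN C hdet] at hcard
  -- the transport `λ ↦ λ ᵥ* C`
  have hdetq : Cq.transpose.det ≠ 0 := by
    rw [Matrix.det_transpose]
    have : Cq.det = ((C.det : ℤ) : ℚ) := by rw [hCq, Int.cast_det]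
    rw [this]; exact_mod_cast hdet
  choose! z hz using fun x (hx : x ∈ 𝔏) => (mem_latN.mp (hmem x hx))
  have hinj : Set.InjOn z ↑𝔏 := by
    intro x hx y hy hxy
    have h : x ᵥ* Cq = y ᵥ* Cq := by rw [hz x hx, hz y hy, hxy]
    rw [← sub_eq_zero]
    refine Matrix.eq_zero_of_mulVec_eq_zero hdetq ?_
    rw [Matrix.mulVec_transpose, Matrix.sub_vecMul, h, sub_self]
  refine ⟨t, 𝔏.image z, ?_, ?_⟩
  · intro μ hμ j
    obtain ⟨x, hx, rfl⟩ := Finset.mem_image.mp hμ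
    -- `(z x) ᵥ* U = N • x`
    have hU : ιZQ n ((z x) ᵥ* U) = (N : ℚ) • x := by
      rw [← ιZQ_vecMul U (z x), ← hz x hx, Matrix.vecMul_vecMul, ← hCq, hCUq, Matrix.vecMul_smul, Matrix.vecMul_one]
    have hj := congrFun hU j
    simp only [ιZQ_apply, Pi.smul_apply, smul_eq_mul] at hj
    have hjR : (((z x ᵥ* U) j : ℤ) : ℝ) = (N : ℝ) * ((x j : ℚ) : ℝ) := by
      have := congrArg (fun q : ℚ => (q : ℝ)) hj
      push_cast at this ⊢
      exact this
    rw [hjR, ← mul_sub, abs_mul, abs_of_nonneg (by positivity : (0 : ℝ) ≤ N)]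
    exact mul_le_mul_of_nonneg_left (hbox x hx j) (by positivity)
  · rw [Finset.card_image_of_injOn hinj]
    exact hcard

end SatBox

end Summit.ABC.StewartYu

end
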